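import Summits.HubbardSuperconductivity.HubbardSuperconductivity.Theorems.AnisotropyChordTransferFibre3DiagRotation

/-!
# Route `AnisotropyChord` / H0 rotor rung: PartN35 LEMMA L2-B1 — POINTWISE brackets for `S2UniformBracket`

Termwise inequalities for the L-uniform bracket of `S₂` (`…Fibre3S2Bracket`, `s2UniformBracket_holds`): with `θ = 2π/L`,
`E = 2(1−cos θx) + 2(1−cos θy) = 2ε(k)` at the centred representative (`two_epsT_eq_rep`),
* `lower_termwise`: `1/(x²+y²−ν)² ≤ θ⁴/(E − νθ²)²` on the window (`2(1−cos t) ≤ t²`, Jordan `(4/π²)t² ≤ 2(1−cos t)`);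
* `window_termwise`: `θ⁴/(E − νθ²)² ≤ 1/((x²(1−θ₀²x²/12) + y²(1−θ₀²y²/12)) − ν)²` (`t² − t⁴/12 ≤ 2(1−cos t)`,
  `sq_sub_quartic_le`, from `sin s ≥ s − s³/6`; `θ ≤ θ₀`, `θ₀K = π/2`);
* `tail_termwise`: `θ⁴/(E − νθ²)² ≤ (π⁴/16)/(S − νπ²/4)²` from Jordan `(4/π²)θ²S ≤ E`.
Prover seat `hubbard-h0-rotor-p3` g2; helper for stmt-HubbardSuperconductivity-19089 (`--supports`, helper class).
Nothing here proves superconductivity in the Hubbard model; helper lemmas of ONE conditional reduction (rung 19089).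
-/

set_option linter.dupNamespace false
set_option autoImplicit false

noncomputable section

open scoped BigOperators

namespace Summit.HubbardSuperconductivity.HubbardSuperconductivity.Theorems.AnisotropyChord.Transfer.Fibre3

variable (L : ℕ) [NeZero L]

/-! ## Elementary cosine brackets -/

/-- `x² − x⁴/12 ≤ 2(1 − cos x)` for `|x| ≤ π` (from `sin y ≥ y − y³/6` at `y = |x|/2`). [folklore] -/
theorem sq_sub_quartic_le (x : ℝ) (hx : |x| ≤ Real.pi) : x ^ 2 - x ^ 4 / 12 ≤ 2 * (1 - Real.cos x) := by
  have hpi := Real.pi_lt_d2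
  set y := |x| with hy
  have hy0 : 0 ≤ y := abs_nonneg x
  have hcos : Real.cos x = Real.cos y := by rw [hy, Real.cos_abs]
  have hx2 : x ^ 2 = y ^ 2 := by rw [hy, sq_abs]
  have hx4 : x ^ 4 = y ^ 4 := by rw [show x ^ 4 = (x ^ 2) ^ 2 by ring, hx2]; ring
  rw [hcos, hx2, hx4]
  have hs : y / 2 - (y / 2) ^ 3 / 6 ≤ Real.sin (y / 2) := Real.sin_ge_sub_cube (by positivity)
  have hnn : 0 ≤ y / 2 - (y / 2) ^ 3 / 6 := by
    have : y ^ 2 ≤ 24 := by nlinarith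
    nlinarith
  have hsq : (y / 2 - (y / 2) ^ 3 / 6) ^ 2 ≤ Real.sin (y / 2) ^ 2 := pow_le_pow_left₀ hnn hs 2
  have hc : Real.cos y = 1 - 2 * Real.sin (y / 2) ^ 2 := by
    rw [Real.sin_sq_eq_half_sub, show 2 * (y / 2) = y by ring]; ring
  rw [hc]
  nlinarith [sq_nonneg (y ^ 3)]

/-- `2(1 − cos x) ≤ x²`. [folklore] -/
theorem two_mul_one_sub_cos_le_sq (x : ℝ) : 2 * (1 - Real.cos x) ≤ x ^ 2 := by
  have := Real.one_sub_sq_div_two_le_cos (x := x)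
  linarith

/-- `(4/π²)x² ≤ 2(1 − cos x)` for `|x| ≤ π`. [folklore] -/
theorem jordan_sq_le (x : ℝ) (hx : |x| ≤ Real.pi) : 4 / Real.pi ^ 2 * x ^ 2 ≤ 2 * (1 - Real.cos x) := by
  have h := Real.cos_le_one_sub_mul_cos_sq hx
  have e : 4 / Real.pi ^ 2 * x ^ 2 = 2 * (2 / Real.pi ^ 2 * x ^ 2) := by ring
  rw [e]
  linarith

/-! ## The torus dispersion at the centred representative -/

/-- `2ε(k) = 2(1 − cos(2π m/L)) + 2(1 − cos(2π n/L))` with `(m,n)` the centred representatives. [folklore] -/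
theorem two_epsT_eq_rep (k : Tor L) :
    2 * epsT L k = 2 * (1 - Real.cos (2 * Real.pi * ((k.1.valMinAbs : ℤ) : ℝ) / L))
      + 2 * (1 - Real.cos (2 * Real.pi * ((k.2.valMinAbs : ℤ) : ℝ) / L)) := by
  have h1 := cos_two_pi_val_intCast L (k.1.valMinAbs)
  have h2 := cos_two_pi_val_intCast L (k.2.valMinAbs)
  rw [ZMod.coe_valMinAbs] at h1 h2
  unfold epsT
  rw [h1, h2]
  ring

/-! ## Pointwise comparisons (pure real inequalities) -/

/-- the basic comparison: if `0 < D ≤ t·c` then `1/c² ≤ t²/D²`. [folklore] -/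
theorem one_div_sq_le (c D t : ℝ) (ht : 0 < t) (hD : 0 < D) (hle : D ≤ t * c) :
    1 / c ^ 2 ≤ t ^ 2 / D ^ 2 := by
  have hc : 0 < c := by
    by_contra h
    push Not at h
    nlinarith
  have h1 : 1 / c ≤ t / D := by
    rw [div_le_div_iff₀ hc hD]
    linarith
  have h2 := pow_le_pow_left₀ (by positivity) h1 2
  rw [div_pow, div_pow, one_pow] at h2
  exact h2

/-- the reverse comparison: if `0 < t·c ≤ D` then `s/D² ≤ s/(t c)²` (`s ≥ 0`). [folklore] -/
theorem sq_div_le (s c D t : ℝ) (hs : 0 ≤ s) (ht : 0 < t) (hc : 0 < c) (hle : t * c ≤ D) :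
    s / D ^ 2 ≤ s / (t * c) ^ 2 :=
  div_le_div_of_nonneg_left hs (by positivity) (pow_le_pow_left₀ (by positivity) hle 2)

/-- an integer pair off the origin has `m² + n² ≥ 1`. [folklore] -/
theorem one_le_sq_add_sq (m n : ℤ) (hp0 : (m, n) ≠ (0, 0)) : (1 : ℝ) ≤ (m : ℝ) ^ 2 + (n : ℝ) ^ 2 := by
  by_cases h1 : m = 0
  · have h2 : n ≠ 0 := fun h2 => hp0 (by rw [h1, h2])
    have h2' : (1 : ℝ) ≤ |(n : ℝ)| := by exact_mod_cast Int.one_le_abs h2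
    nlinarith [abs_nonneg (n : ℝ), sq_abs (n : ℝ), sq_nonneg (m : ℝ)]
  · have h1' : (1 : ℝ) ≤ |(m : ℝ)| := by exact_mod_cast Int.one_le_abs h1
    nlinarith [abs_nonneg (m : ℝ), sq_abs (m : ℝ), sq_nonneg (n : ℝ)]

/-- a window coordinate gives an angle of modulus at most `π`. [folklore] -/
theorem abs_angle_le_pi (θ : ℝ) (K : ℕ) (hθ : 0 < θ) (hθK : θ * K ≤ Real.pi / 2) (m : ℤ)
    (h1 : -(K : ℤ) ≤ m) (h2 : m ≤ K) : |θ * (m : ℝ)| ≤ Real.pi := by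
  rw [abs_mul, abs_of_pos hθ]
  have : |(m : ℝ)| ≤ K := by
    rw [abs_le]; constructor <;> exact_mod_cast (by omega : _)
  nlinarith [abs_nonneg (m : ℝ), Real.pi_pos]

/-- LOWER termwise: `1/(|p|²−ν)² ≤ θ⁴/(E − νθ²)²`, `E = 2(1−cos θx) + 2(1−cos θy)`, on the window. [folklore] -/
theorem lower_termwise (θ ν x y : ℝ) (hθ : 0 < θ) (hν : ν < 4 / Real.pi ^ 2) (hS : 1 ≤ x ^ 2 + y ^ 2)
    (hx : |θ * x| ≤ Real.pi) (hy : |θ * y| ≤ Real.pi) :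
    1 / ((x ^ 2 + y ^ 2) - ν) ^ 2
      ≤ θ ^ 4 / ((2 * (1 - Real.cos (θ * x)) + 2 * (1 - Real.cos (θ * y))) - ν * θ ^ 2) ^ 2 := by
  have up1 := two_mul_one_sub_cos_le_sq (θ * x)
  have up2 := two_mul_one_sub_cos_le_sq (θ * y)
  have lo1 := jordan_sq_le (θ * x) hx
  have lo2 := jordan_sq_le (θ * y) hy
  have hθ2 := pow_pos hθ 2
  have hD : 0 < (2 * (1 - Real.cos (θ * x)) + 2 * (1 - Real.cos (θ * y))) - ν * θ ^ 2 := by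
    have e : 4 / Real.pi ^ 2 * (θ * x) ^ 2 + 4 / Real.pi ^ 2 * (θ * y) ^ 2
        = 4 / Real.pi ^ 2 * θ ^ 2 * (x ^ 2 + y ^ 2) := by ring
    have h1 : 4 / Real.pi ^ 2 * θ ^ 2 * 1 ≤ 4 / Real.pi ^ 2 * θ ^ 2 * (x ^ 2 + y ^ 2) :=
      mul_le_mul_of_nonneg_left hS (by positivity)
    have h2 : ν * θ ^ 2 < 4 / Real.pi ^ 2 * θ ^ 2 := by nlinarith
    linarith
  have hle : (2 * (1 - Real.cos (θ * x)) + 2 * (1 - Real.cos (θ * y))) - ν * θ ^ 2 ≤ θ ^ 2 * ((x ^ 2 + y ^ 2) - ν) := by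
    have e : θ ^ 2 * ((x ^ 2 + y ^ 2) - ν) = (θ * x) ^ 2 + (θ * y) ^ 2 - ν * θ ^ 2 := by ring
    rw [e]
    linarith
  have key := one_div_sq_le ((x ^ 2 + y ^ 2) - ν) _ (θ ^ 2) hθ2 hD hle
  rw [show (θ ^ 2) ^ 2 = θ ^ 4 by ring] at key
  exact key
set_option maxHeartbeats 400000 in
/-- WINDOW termwise: `θ⁴/(E − νθ²)² ≤ 1/((x²(1−θ₀²x²/12) + y²(1−θ₀²y²/12)) − ν)²`. [folklore] -/
theorem window_termwise (θ θ0 ν x y Kr : ℝ) (hθ : 0 < θ) (hθle : θ ≤ θ0) (hθ0K : θ0 * Kr = Real.pi / 2)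
    (hν : ν < 4 / Real.pi ^ 2) (hS : 1 ≤ x ^ 2 + y ^ 2) (hx2 : x ^ 2 ≤ Kr ^ 2) (hy2 : y ^ 2 ≤ Kr ^ 2)
    (hx : |θ * x| ≤ Real.pi) (hy : |θ * y| ≤ Real.pi) :
    θ ^ 4 / ((2 * (1 - Real.cos (θ * x)) + 2 * (1 - Real.cos (θ * y))) - ν * θ ^ 2) ^ 2
      ≤ 1 / ((x ^ 2 * (1 - θ0 ^ 2 * x ^ 2 / 12) + y ^ 2 * (1 - θ0 ^ 2 * y ^ 2 / 12)) - ν) ^ 2 := by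
  have hpi3 := Real.pi_gt_three
  have hpi315 := Real.pi_lt_d2
  have t1 := sq_sub_quartic_le (θ * x) hx
  have t2 := sq_sub_quartic_le (θ * y) hy
  have hθ2 : θ ^ 2 ≤ θ0 ^ 2 := pow_le_pow_left₀ hθ.le hθle 2
  have hθ0K2 : θ0 ^ 2 * Kr ^ 2 = Real.pi ^ 2 / 4 := by
    rw [show θ0 ^ 2 * Kr ^ 2 = (θ0 * Kr) ^ 2 by ring, hθ0K]; ring
  have f1 : θ0 ^ 2 * x ^ 2 ≤ Real.pi ^ 2 / 4 := by
    have : θ0 ^ 2 * x ^ 2 ≤ θ0 ^ 2 * Kr ^ 2 := mul_le_mul_of_nonneg_left hx2 (sq_nonneg _)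
    linarith
  have f2 : θ0 ^ 2 * y ^ 2 ≤ Real.pi ^ 2 / 4 := by
    have : θ0 ^ 2 * y ^ 2 ≤ θ0 ^ 2 * Kr ^ 2 := mul_le_mul_of_nonneg_left hy2 (sq_nonneg _)
    linarith
  -- positivity of the window denominator
  have g1 : (1 - Real.pi ^ 2 / 48) * x ^ 2 ≤ x ^ 2 * (1 - θ0 ^ 2 * x ^ 2 / 12) := by
    have h := mul_nonneg (sq_nonneg x) (sub_nonneg.2 f1)
    nlinarith [h]
  have g2 : (1 - Real.pi ^ 2 / 48) * y ^ 2 ≤ y ^ 2 * (1 - θ0 ^ 2 * y ^ 2 / 12) := by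
    have h := mul_nonneg (sq_nonneg y) (sub_nonneg.2 f2)
    nlinarith [h]
  have g3 : ν < 4 / 9 := by
    calc ν < 4 / Real.pi ^ 2 := hν
      _ ≤ 4 / 9 := by
        apply div_le_div_of_nonneg_left (by norm_num) (by norm_num)
        nlinarith
  have gπ : Real.pi ^ 2 < 10 := by nlinarith
  have g5 : (1 - Real.pi ^ 2 / 48) * 1 ≤ (1 - Real.pi ^ 2 / 48) * (x ^ 2 + y ^ 2) :=
    mul_le_mul_of_nonneg_left hS (by linarith)
  have hBqpos : 0 < (x ^ 2 * (1 - θ0 ^ 2 * x ^ 2 / 12) + y ^ 2 * (1 - θ0 ^ 2 * y ^ 2 / 12)) - ν := by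
    linarith
  -- the Taylor comparison
  have q1 : θ ^ 2 * (x ^ 2 * (1 - θ0 ^ 2 * x ^ 2 / 12)) ≤ (θ * x) ^ 2 - (θ * x) ^ 4 / 12 := by
    have h := mul_nonneg (mul_nonneg (sq_nonneg θ) (sq_nonneg (x ^ 2))) (sub_nonneg.2 hθ2)
    nlinarith [h]
  have q2 : θ ^ 2 * (y ^ 2 * (1 - θ0 ^ 2 * y ^ 2 / 12)) ≤ (θ * y) ^ 2 - (θ * y) ^ 4 / 12 := by
    have h := mul_nonneg (mul_nonneg (sq_nonneg θ) (sq_nonneg (y ^ 2))) (sub_nonneg.2 hθ2)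
    nlinarith [h]
  have hle : θ ^ 2 * ((x ^ 2 * (1 - θ0 ^ 2 * x ^ 2 / 12) + y ^ 2 * (1 - θ0 ^ 2 * y ^ 2 / 12)) - ν)
      ≤ (2 * (1 - Real.cos (θ * x)) + 2 * (1 - Real.cos (θ * y))) - ν * θ ^ 2 := by
    have e : θ ^ 2 * ((x ^ 2 * (1 - θ0 ^ 2 * x ^ 2 / 12) + y ^ 2 * (1 - θ0 ^ 2 * y ^ 2 / 12)) - ν)
        = θ ^ 2 * (x ^ 2 * (1 - θ0 ^ 2 * x ^ 2 / 12)) + θ ^ 2 * (y ^ 2 * (1 - θ0 ^ 2 * y ^ 2 / 12))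
          - ν * θ ^ 2 := by ring
    rw [e]
    linarith
  have key := sq_div_le (θ ^ 4) _ _ (θ ^ 2) (by positivity) (pow_pos hθ 2) hBqpos hle
  have e : θ ^ 4 / (θ ^ 2 * ((x ^ 2 * (1 - θ0 ^ 2 * x ^ 2 / 12) + y ^ 2 * (1 - θ0 ^ 2 * y ^ 2 / 12)) - ν)) ^ 2
      = 1 / ((x ^ 2 * (1 - θ0 ^ 2 * x ^ 2 / 12) + y ^ 2 * (1 - θ0 ^ 2 * y ^ 2 / 12)) - ν) ^ 2 := by
    have hθ0' : θ ^ 2 ≠ 0 := by positivity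
    rw [mul_pow, show θ ^ 4 = (θ ^ 2) ^ 2 by ring, ← div_div, div_self (pow_ne_zero 2 hθ0')]
  rw [e] at key
  exact key

/-- TAIL termwise: from Jordan `(4/π²)θ²S ≤ E`: `θ⁴/(E − νθ²)² ≤ (π⁴/16)/(S − νπ²/4)²` (`S > νπ²/4`). [folklore] -/
theorem tail_termwise (θ ν S E : ℝ) (hθ : 0 < θ) (hS : ν * Real.pi ^ 2 / 4 < S)
    (hjordan : 4 / Real.pi ^ 2 * θ ^ 2 * S ≤ E) :
    θ ^ 4 / (E - ν * θ ^ 2) ^ 2 ≤ Real.pi ^ 4 / 16 * (1 / (S - ν * Real.pi ^ 2 / 4) ^ 2) := by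
  have hpi := Real.pi_pos
  have hc : 0 < S - ν * Real.pi ^ 2 / 4 := by linarith
  have hle : (4 / Real.pi ^ 2 * θ ^ 2) * (S - ν * Real.pi ^ 2 / 4) ≤ E - ν * θ ^ 2 := by
    have : 4 / Real.pi ^ 2 * θ ^ 2 * (ν * Real.pi ^ 2 / 4) = ν * θ ^ 2 := by field_simp
    nlinarith
  have key := sq_div_le (θ ^ 4) _ _ (4 / Real.pi ^ 2 * θ ^ 2) (by positivity) (by positivity) hc hle
  have e : θ ^ 4 / (4 / Real.pi ^ 2 * θ ^ 2 * (S - ν * Real.pi ^ 2 / 4)) ^ 2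
      = Real.pi ^ 4 / 16 * (1 / (S - ν * Real.pi ^ 2 / 4) ^ 2) := by
    have hθ0' : θ ≠ 0 := hθ.ne'
    field_simp
    ring
  rw [e] at key
  exact key

end Summit.HubbardSuperconductivity.HubbardSuperconductivity.Theorems.AnisotropyChord.Transfer.Fibre3

end
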